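import Summits.ResolutionOfSingularities.ResolutionOfSingularities.Theorems.FrobeniusLadderFRationalResolutionGaloisTwistInvariants
import Mathlib.RingTheory.Flat.FaithfullyFlat.Algebra
import Mathlib.RingTheory.TensorProduct.Free
import HarnessLib

/-!
# Crux `FrobeniusLadder.FRationalResolution` (stmt-ResolutionOfSingularities-15317), line `redirect`,
# stub `stub_diagonalizableQuotientResolution` — the FIBRE of `Spec(B ⊗_K K') → Spec B` over a closed point: non-empty, closed
# points only, ONE Galois orbit (the data «ONE maximal `𝔔'` over `𝔭`» of the Galois-route assembly)

* `exists_isMaximal_comap_eq` — for `K'/K` a finite field extension and `𝔭 ⊆ B` maximal there is a maximal `𝔔' ⊆ B ⊗_K K'` over `𝔭`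
  (`B ⊗_K K'` is free, hence faithfully flat, over `B`; primes over a maximal ideal of an integral extension are maximal);
* `isMaximal_of_comap_eq` — every prime of `B ⊗_K K'` over the maximal `𝔭` is maximal;
* `exists_eq_map_twist_of_comap_eq` — for `K'/K` finite Galois the primes over `𝔭` form ONE orbit under the twists `1 ⊗ σ`
  (`…GaloisTwistInvariants.exists_map_twist_eq_of_comap_eq`).

Honest label: generic plumbing (no stub closed by name). No definitions, no named facts, no sorry.
[cite: StacksProject, Tag 09EB; Tag 00GQ]
-/

noncomputable section

-- single-problem summit: the doubled namespace component is forced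
set_option linter.dupNamespace false

open TensorProduct

namespace Summit.ResolutionOfSingularities.ResolutionOfSingularities.Theorems.FRationalResolution.GaloisFibre

variable {K K' B : Type} [Field K] [Field K'] [Algebra K K'] [CommRing B] [Algebra K B]

/-- Every prime of `B ⊗_K K'` over a maximal ideal of `B` is maximal (`K'/K` algebraic, so `B ⊗_K K'` is integral over `B`).
[cite: StacksProject, Tag 00GQ] -/
theorem isMaximal_of_comap_eq [Algebra.IsAlgebraic K K'] (𝔭 : Ideal B) [h𝔭 : 𝔭.IsMaximal] (Q : Ideal (B ⊗[K] K'))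
    [Q.IsPrime] (hQ : Q.comap (algebraMap B (B ⊗[K] K')) = 𝔭) : Q.IsMaximal := by
  haveI : Algebra.IsIntegral B (B ⊗[K] K') := inferInstance
  exact Ideal.isMaximal_of_isIntegral_of_isMaximal_comap Q (hQ ▸ h𝔭)

/-- **There is a maximal ideal of `B ⊗_K K'` over any maximal ideal of `B`** (`K'/K` a finite extension, `B` non-trivial).
[cite: StacksProject, Tag 00GQ] -/
theorem exists_isMaximal_comap_eq [FiniteDimensional K K'] [Nontrivial B] (𝔭 : Ideal B) [h𝔭 : 𝔭.IsMaximal] :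
    ∃ (𝔔' : Ideal (B ⊗[K] K')), 𝔔'.IsMaximal ∧ 𝔔'.comap (algebraMap B (B ⊗[K] K')) = 𝔭 := by
  haveI : Module.FaithfullyFlat B (B ⊗[K] K') := inferInstance
  obtain ⟨q, hq⟩ := PrimeSpectrum.comap_surjective_of_faithfullyFlat (B := B ⊗[K] K') ⟨𝔭, h𝔭.isPrime⟩
  have hq' : q.asIdeal.comap (algebraMap B (B ⊗[K] K')) = 𝔭 := congrArg PrimeSpectrum.asIdeal hq
  exact ⟨q.asIdeal, isMaximal_of_comap_eq 𝔭 q.asIdeal hq', hq'⟩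

/-- **The primes over `𝔭` form ONE Galois orbit**: for `K'/K` finite Galois, a maximal `𝔔'` over `𝔭` and any prime `Q` over `𝔭`,
`Q = (1 ⊗ σ) 𝔔'` for some `σ ∈ Gal(K'/K)`. [cite: StacksProject, Tag 09EB] -/
theorem exists_eq_map_twist_of_comap_eq [FiniteDimensional K K'] [IsGalois K K'] (𝔭 : Ideal B)
    (𝔔' : Ideal (B ⊗[K] K')) [𝔔'.IsPrime] (h𝔔' : 𝔔'.comap (algebraMap B (B ⊗[K] K')) = 𝔭)
    (Q : Ideal (B ⊗[K] K')) [Q.IsPrime] (hQ : Q.comap (algebraMap B (B ⊗[K] K')) = 𝔭) :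
    ∃ σ : K' ≃ₐ[K] K', Q = 𝔔'.map (Algebra.TensorProduct.map (AlgHom.id B B) (σ : K' →ₐ[K] K')) :=
  GaloisTwistInvariants.exists_map_twist_eq_of_comap_eq 𝔔' Q (h𝔔'.trans hQ.symm)

end Summit.ResolutionOfSingularities.ResolutionOfSingularities.Theorems.FRationalResolution.GaloisFibre

end
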